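import Literature.Barriers.SmoothPoincare4.CappellShanesonFamilyStandardNegSixEleven
import Literature.Topology.FourManifolds.CappellShanesonTraceClassesProofs
import Literature.Topology.FourManifolds.CappellShanesonDeltaMoveProofs
import HarnessLib

/-!
# Towards `gompf2010_theorem32_d_holds`: Gompf 2010, Thm. 3.2 (`|d| < 17`) from the two live
# geometric leaves

Second sibling proof file of `Literature/Barriers/SmoothPoincare4/CappellShanesonFamilyStandard.lean`
(after `CappellShanesonFamilyStandardProofs.lean`, whose Part I proves the assembly
`gompf2010_theorem32_d_of hΔ h43 hAK hAR hAR5` of R. Gompf, *More Cappell–Shaneson spheres are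
standard*, Algebr. Geom. Topol. 10 (2010) 1665–1681, Thm. 3.2, last sentence, from five named
facts). Since that assembly landed, the tree has DISCHARGED or REDUCED every one of its five
hypotheses:

* the number theory (Aitchison–Rubinstein, Contemp. Math. 35 (1984), Appendix "Conjugacy in
  `SL(3, ℤ)`", Newman's theorem = Latimer–MacDuffee–Taussky, and Table 1):
  `aitchisonRubinstein1984_uniqueTraceClass_holds` (one class for each trace in `[-4, 9]`,
  `CappellShanesonClassNumberOneLarge.lean`) and
  `aitchisonRubinstein1984_traceNegFiveClasses_holds` (the two classes of trace `-5`,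
  `CappellShanesonTraceClassesProofs.lean`) are theorems;
* the Δ-move `gompf2010_deltaMove` (Thm. 2.1/§3) follows from the framed Theorem 2.1
  **F** = `gompf2010_framedTwist` and the proved classification of Cappell–Shaneson spheres by
  straightenings (`gompf2010_deltaMove_of_framedTwist'` of `CappellShanesonDeltaMoveProofs.lean` =
  `gompf2010_deltaMove_of_framedTwist` + `gompf2010_straightening_classification_holds`);
* Theorem 4.3, `gompf2010_akbulutKirby_framings`, follows from **F** alone
  (`gompf2010_akbulutKirby_framings_of_framedTwist`: straightening invariance, conjugation
  invariance, `π₁ GL⁺(3, ℝ) = ℤ/2`, the essential framing loop and the Δ₀-instance **F₀** being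
  proved, `GompfFramedTwistZero.lean`);
* [AK1], `akbulutKirby1979_sphere_four`, follows from its framed form
  **AK1** = `akbulutKirby1979_linearStraightening` (`akbulutKirby1979_sphere_four_of_framed`).

This file records the resulting two-leaf form: `gompf2010_theorem32_d` (and with it Thm. 3.2
first sentence, Cor. 3.5 and the small-entry barrier `CappellShanesonSmallEntryBarrier`) from
**F** and **AK1** only — the same live leaf set as for the family barrier
(`cappellShanesonFamilyBarrier_of_framedTwist_AK`). No new definitions, no new named facts.

## What remains for `gompf2010_theorem32_d_holds`

Exactly the two geometric leaves, both XL and owned by their provefact units: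
`Literature.Topology.FourManifolds.gompf2010_framedTwist` (Gompf 2010, Thm. 2.1 for the Δ-moves
on Gompf's concrete spheres `X^σ_A`: fishtail neighbourhoods and Lemma 2.2, the multiplicity-one
logarithmic transformation) and `Literature.Topology.FourManifolds.akbulutKirby1979_linearStraightening`
(Akbulut–Kirby 1979: the untwisted `A₀`-sphere is `S⁴`, a cancelling handle diagram). When
`gompf2010_framedTwist_holds` and `akbulutKirby1979_linearStraightening_holds` land,
`gompf2010_theorem32_d_holds` is `gompf2010_theorem32_d_of_framedTwist_AK` applied to them.

## References

* [GompfAGT2010] R. E. Gompf, *More Cappell–Shaneson spheres are standard*, Algebr. Geom. Topol.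
  10 (2010) 1665–1681, doi:10.2140/agt.2010.10.1665: Thm. 2.1, §3 (Examples 3.1, Thm. 3.2,
  Lemma 3.3, Thm. 3.4, Cor. 3.5), Thm. 4.3.
* [AitchisonRubinstein1984] I. R. Aitchison, J. H. Rubinstein, *Fibered knots and involutions on
  homotopy spheres*, Contemp. Math. 35 (1984) 1–74, Appendix "Conjugacy in `SL(3, ℤ)`", Table 1.
* [AkbulutKirby1979] S. Akbulut, R. Kirby, *An exotic involution of `S⁴`*, Topology 18 (1979)
  75–81.
-/

noncomputable section

open Set Literature.Topology.FourManifolds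
open scoped MatrixGroups Manifold ContDiff

namespace Literature.Barriers.SmoothPoincare4

universe u

/-- **Gompf 2010, Thm. 3.2, last sentence (`|d| < 17`; the named fact `gompf2010_theorem32_d`)
from the two live geometric leaves F and AK1.** The five hypotheses of
`gompf2010_theorem32_d_of` are fed by: the Δ-move from **F**
(`gompf2010_deltaMove_of_framedTwist'`, `CappellShanesonDeltaMoveProofs.lean`), Theorem 4.3 from **F**
(`gompf2010_akbulutKirby_framings_of_framedTwist`), [AK1] from **AK1**
(`akbulutKirby1979_sphere_four_of_framed`), and the two Aitchison–Rubinstein facts, now theorems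
(`aitchisonRubinstein1984_uniqueTraceClass_holds`,
`aitchisonRubinstein1984_traceNegFiveClasses_holds`). When **F** and **AK1** are discharged,
`gompf2010_theorem32_d_holds` is this theorem applied to their proofs. [cite: GompfAGT2010, Thm. 3.2 (proof) and Lemma 3.3] -/
theorem gompf2010_theorem32_d_of_framedTwist_AK (hF : gompf2010_framedTwist)
    (hAK : akbulutKirby1979_linearStraightening) : gompf2010_theorem32_d.{u} :=
  gompf2010_theorem32_d_of (gompf2010_deltaMove_of_framedTwist' hF)
    (gompf2010_akbulutKirby_framings_of_framedTwist hF) (akbulutKirby1979_sphere_four_of_framed hAK)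
    aitchisonRubinstein1984_uniqueTraceClass_holds aitchisonRubinstein1984_traceNegFiveClasses_holds

/-- **Thm. 3.2, first sentence** (`gompf2010_theorem32`: `tr A ≡ r (mod d)` with `-6 ≤ r ≤ 9` or
a unique class at trace `r` ⟹ standard) **from F and AK1**, all three Aitchison–Rubinstein inputs
(traces `[-4, 9]`, `-5`, and `-6, 11`) being theorems. [cite: GompfAGT2010, Thm. 3.2 (proof)] -/
theorem gompf2010_theorem32_of_framedTwist_AK (hF : gompf2010_framedTwist)
    (hAK : akbulutKirby1979_linearStraightening) : gompf2010_theorem32.{u} :=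
  gompf2010_theorem32_of_leaves_of_negFive (gompf2010_deltaMove_of_framedTwist' hF)
    (gompf2010_akbulutKirby_framings_of_framedTwist hF) (akbulutKirby1979_sphere_four_of_framed hAK)
    aitchisonRubinstein1984_traceNegFiveClasses_holds

/-- **Cor. 3.5** (an exotic Cappell–Shaneson sphere of a matrix in standard form with
`det (A - 1) = 1` needs `|d| ≥ 17`, `|a + ce| ≥ 9`, `|c - 1/2| > 4`, `|c + f - 3/2| > 8`; the last two
doubled to stay in `ℤ`) **from F and AK1.** The conclusion is the statement of Cor. 3.5 as rendered
in the tree — verbatim the body of the former named fact `gompf2010_corollary35` of the barrier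
file, merged back by its D-0026/D-0027 review (2026-08-15): the corollary's discharge is exactly
this theorem applied to `gompf2010_framedTwist_holds` and
`akbulutKirby1979_linearStraightening_holds` once those land, so it is not an obligation of its
own. [cite: GompfAGT2010, Cor. 3.5] -/
theorem gompf2010_corollary35_of_framedTwist_AK (hF : gompf2010_framedTwist)
    (hAK : akbulutKirby1979_linearStraightening) :
    ∀ (A : SL(3, ℤ)), IsGompfStandardForm A → (A.1 - 1).det = 1 →
      ∀ (X : Type u) [TopologicalSpace X] [T2Space X] [SecondCountableTopology X]
        [ChartedSpace (EuclideanSpace ℝ (Fin 4)) X] [IsManifold (𝓡 4) ∞ X] [CompactSpace X],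
        IsCappellShanesonSphereOf A X →
        IsEmpty (X ≃ₘ⟮𝓡 4, 𝓡 4⟯ (Metric.sphere (0 : EuclideanSpace ℝ (Fin (4 + 1))) 1)) →
          17 ≤ |A.1 1 2| ∧ 9 ≤ |A.1 0 1 + A.1 1 1 * A.1 2 1| ∧ 8 < |2 * A.1 1 1 - 1| ∧
            16 < |2 * (A.1 1 1 + A.1 2 2) - 3| :=
  gompf2010_corollary35_of_leaves_of_negFive (gompf2010_deltaMove_of_framedTwist' hF)
    (gompf2010_akbulutKirby_framings_of_framedTwist hF) (akbulutKirby1979_sphere_four_of_framed hAK)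
    aitchisonRubinstein1984_traceNegFiveClasses_holds

/-- **The small-entry barrier `CappellShanesonSmallEntryBarrier` from F and AK1** (no
Cappell–Shaneson sphere of a standard-form matrix with `det (A - 1) = 1` and `|d| < 17` is
exotic), via `cappellShanesonSmallEntryBarrier_of_gompf`. [cite: GompfAGT2010, Thm. 3.2] -/
theorem cappellShanesonSmallEntryBarrier_of_framedTwist_AK (hF : gompf2010_framedTwist)
    (hAK : akbulutKirby1979_linearStraightening) : CappellShanesonSmallEntryBarrier :=
  cappellShanesonSmallEntryBarrier_of_gompf (gompf2010_theorem32_d_of_framedTwist_AK hF hAK)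

end Literature.Barriers.SmoothPoincare4

end
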